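import Mathlib
import HarnessLib
import Literature.MathematicalPhysics.QuantumLattice.HubbardFrameNormalisation
import Literature.MathematicalPhysics.QuantumLattice.GrassmannLaplacianPairWick

/-!
# Child 4 `KLRegimeTwoPointAssembly` (stmt-HubbardSuperconductivity-19637), stub `stub_asm_frame`:
# same model, frame moved — the countertermed Grassmann expectations are the bare ones times ONE non-zero constant

The registered stub of the skeleton `Lines/asm-repr` (lead hubbard-kl-r2d-p2).  Everything is in the tree already
(`HubbardCovarianceFrameResolvent.gaussExpect_hubbardCovarianceCT_counterterm_mul`: `∫dμ_{C^K} e^{−𝒩_K} G = Z_K ∫dμ_C G`;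
`HubbardFrameNormalisation.gaussExpect_counterQuadratic_ne_zero`: `Z_K ≠ 0`); here `G = F e^{−V}` and
`e^{−V_K} = e^{−(V+𝒩_K)} = e^{−𝒩_K} e^{−V}` with `e^{−𝒩_K}` central.
-/

noncomputable section

namespace Summit.HubbardSuperconductivity.HubbardSuperconductivity.Theorems.TwoPointAssembly

set_option linter.dupNamespace false -- summit = problem name (single-conjunct summit), D-0017

open Literature.MathematicalPhysics.QuantumLattice Literature.Probability.LatticeModels GrassmannAlgebra

/-- The counterterm vertex `𝒩_K` is even (a sum of `ψ⁺ψ⁻` bilinears). -/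
theorem counterQuadratic_even (L M : ℕ) [NeZero L] (β : ℝ) (K : TrigPolyC4v) :
    counterQuadratic L M β K ∈ evenOdd ℂ 0 := by
  rw [counterQuadratic]
  exact Submodule.sum_mem _ fun k _ => Submodule.sum_mem _ fun σ _ =>
    Submodule.smul_mem _ _ (gen_mul_gen_mem_evenOdd_zero ℂ _ _)

/-- `e^{−(V + 𝒩_K)} = e^{−𝒩_K} e^{−V}` (commuting nilpotents). -/
theorem grassmannExp_neg_hubbardInteractionCT (L M : ℕ) [NeZero L] (β U : ℝ) (K : TrigPolyC4v) :
    grassmannExp (-(hubbardInteractionCT L M β U K)) =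
      grassmannExp (-(counterQuadratic L M β K)) * grassmannExp (-(hubbardInteraction L M β U)) := by
  have hV : IsNilpotent (-(hubbardInteraction L M β U)) :=
    isNilpotent_of_constPart_eq_zero ℂ (by rw [map_neg, constPart_hubbardInteraction, neg_zero])
  have hN : IsNilpotent (-(counterQuadratic L M β K)) :=
    isNilpotent_of_constPart_eq_zero ℂ (by rw [map_neg, constPart_counterQuadratic, neg_zero])
  have hcomm : Commute (-(counterQuadratic L M β K)) (-(hubbardInteraction L M β U)) :=
    ((commute_of_mem_evenOdd_zero ℂ (counterQuadratic_even L M β K) _).neg_left).neg_right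
  rw [hubbardInteractionCT, neg_add, add_comm, grassmannExp, grassmannExp, grassmannExp,
    IsNilpotent.exp_add_of_commute hcomm hN hV]

/-- **`stub_asm_frame`** (registered signature): one non-zero constant `N = ∫dμ_{C^K} e^{−𝒩_K}` converts every
un-normalised countertermed expectation into the bare one. -/
theorem stub_asm_frame : ∀ (L M : ℕ) [NeZero L] [NeZero M] (β : ℝ), 0 < β → ∀ (μ U : ℝ) (K : TrigPolyC4v),
    ∃ N : ℂ, N ≠ 0 ∧ ∀ F : HubbardGrassmann L M,
      gaussExpect ℂ (hubbardCovarianceCT L M β μ 0 K) (F * grassmannExp (-(hubbardInteractionCT L M β U K))) =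
        N * gaussExpect ℂ (hubbardCovariance L M β μ 0) (F * grassmannExp (-(hubbardInteraction L M β U))) := by
  intro L M _ _ β hβ μ U K
  refine ⟨gaussExpect ℂ (hubbardCovarianceCT L M β μ 0 K) (grassmannExp (-counterQuadratic L M β K)),
    gaussExpect_counterQuadratic_ne_zero β μ 0 K hβ.ne', fun F => ?_⟩
  have hN0 : grassmannExp (-(counterQuadratic L M β K)) ∈ evenOdd ℂ 0 :=
    grassmannExp_mem_evenOdd_zero ℂ (neg_mem (counterQuadratic_even L M β K))
      (isNilpotent_of_constPart_eq_zero ℂ (by rw [map_neg, constPart_counterQuadratic, neg_zero]))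
  rw [grassmannExp_neg_hubbardInteractionCT, ← mul_assoc,
    show F * grassmannExp (-counterQuadratic L M β K) = grassmannExp (-counterQuadratic L M β K) * F from
      ((commute_of_mem_evenOdd_zero ℂ hN0 F).eq).symm, mul_assoc,
    gaussExpect_hubbardCovarianceCT_counterterm_mul L M μ 0 K hβ.ne']

end Summit.HubbardSuperconductivity.HubbardSuperconductivity.Theorems.TwoPointAssembly

end
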